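import Summits.MatrixMultiplication.OmegaCensus.ThreeSetZ5Z65Cells3x
import HarnessLib

/-!
# The census cells `(3,3,12)@325` and `(3,4,9)@325` of `ℤ₅ × ℤ₆₅`: TPP statements and instances

ω-census `pub-omega`, family (b3), seat pub-omega-group gen 37.  Framing: lottery ticket; floor = certified bounds/negative
ranges.  VALUE: the law-level (TPP) form of `ThreeSetZ5Z65Cells3x.lean`: in every dihedral-like group over `A = ℤ₅ × ℤ₆₅` (order
`325`, any `c₀`) NO TPP triple with balanced coset parts having a part `3` and another part `3` or `4` (any positions) attains
`3|S||T||U| + 8 = 8|A|`.  Census: the cells `(3,3,12)` and `(3,4,9)` of `ℤ₅ × ℤ₆₅` (NR79; hitherto ENGINE ×2/×3) are KERNEL; together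
with `no_law_cube_three_six_z5_z65` (gen 36) EVERY three-set cell (part sizes `≥ 3`) of order `325` is a kernel theorem.  NOT progress
on ω.
* `Z5Z5ThreeSet.projZ13` — the projection `ℤ₅ × ℤ₆₅ → ℤ₁₃`; `projZ13_fibre_sum` — its sums over the fibres of `projZ5Z65` vanish
  (one kernel computation);
* `no_law_cube_3xe_of_card325` (generic `d` through the finite statement), `no_law_cube_three_three_of_card325`,
  `no_law_cube_three_four_of_card325` (all orderings, via `no_law_cube_two_parts_of_ordered`);
* **`no_law_cube_three_three_z5_z65`**, **`no_law_cube_three_four_z5_z65`** — the census instances.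
-/

namespace Summit.MatrixMultiplication.OmegaCensus

open Finset ZpZpDomino Z5Z5ThreeSet Literature.Combinatorics.Additive

/-- The projection `ℤ₅ × ℤ₆₅ ↠ ℤ₁₃`, `(a, b) ↦ b mod 13`. [folklore] -/
def Z5Z5ThreeSet.projZ13 : ZMod 5 × ZMod 65 →+ ZMod 13 :=
  (ZMod.castHom (show 13 ∣ 65 by norm_num) (ZMod 13)).toAddMonoidHom.comp (AddMonoidHom.snd (ZMod 5) (ZMod 65))

/-- `projZ13` is non-zero. [folklore] -/
theorem Z5Z5ThreeSet.projZ13_ne_zero : projZ13 ≠ 0 := by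
  intro h
  have h1 : projZ13 (0, 1) = 0 := by rw [h]; rfl
  exact absurd h1 (by decide)

/-- **The fibre sums of `projZ13` along `projZ5Z65` vanish** (each fibre `{(t₁, t₂ + 5k)}` maps onto `ℤ₁₃`). [folklore] -/
theorem Z5Z5ThreeSet.projZ13_fibre_sum (t : ZMod 5 × ZMod 5) :
    ∑ a ∈ univ.filter (fun a : ZMod 5 × ZMod 65 => projZ5Z65 a = t), projZ13 a = 0 := by
  revert t; decide +kernel

section DihedralLike

variable {A : Type} [AddCommGroup A] [DecidableEq A] [Fintype A] {G : Type} [Group G] [DecidableEq G]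
  {ρ τ : A → G} {c₀ : A} {S T U : Finset G}

/-- **No `(3,3 | d,d | e,e)` law triple** (`d ∈ {3,4}` through `hfin`) over `A` of order `325` (every element a double) with
`Φ : A ↠ ℤ₅²` and a non-zero `Ψ : A →+ ZMod 13` whose `Φ`-fibre sums vanish; dihedral-like `G`, any `c₀`. [folklore] -/
theorem no_law_cube_3xe_of_card325 (d : ℕ)
    (hfin : ∀ g : Fin (5 * 5) → ℕ, ∑ i, g i = d → ∀ σ : ℕ, σ < 25 →
      (∃ j < 6, ∃ certs : List (ℕ × List ℕ),
        lineCert3At 5 (vecFn (wvec j)) (vecFn (cnts 5 j g)) certs ((pv 5 j σ : ℕ) : ZMod 5) = true) ∨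
      ∃ e : List ℕ, (∀ i : Fin (5 * 5), g i = e.getD i.val 0) ∧ bridgeOK e = true ∧
        ((∃ c : ℕ × ℕ × List ℤ, c.1 < 25 ∧ refuteRowOK e σ c = true) ∨
         (σ = 12 ∧ ∃ h : List ℕ, ∃ rows : List (ℕ × List ℤ), ∃ L₁ L₂ : List ℕ,
            pinRowsOK e 12 h rows = true ∧ momentCertOK e h L₁ 1 0 = true ∧ momentCertOK e h L₂ 0 1 = true)))
    (hA : Fintype.card A = 325)
    (hρρ : ∀ a b, ρ a * ρ b = ρ (a + b)) (hρτ : ∀ a b, ρ a * τ b = τ (b - a))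
    (hτρ : ∀ a b, τ a * ρ b = τ (a + b)) (hττ : ∀ a b, τ a * τ b = ρ (c₀ + b - a))
    (hρ : Function.Injective ρ) (hτ : Function.Injective τ) (hne : ∀ a b, ρ a ≠ τ b)
    (hsurj : ∀ g, (∃ a, ρ a = g) ∨ (∃ a, τ a = g)) (hhalf : ∀ c : A, ∃ a : A, a + a = c)
    (Φ : A →+ ZMod 5 × ZMod 5) (hΦ : Function.Surjective Φ)
    (Ψ : A →+ ZMod 13) (hΨ : Ψ ≠ 0) (hΨΦ : ∀ t : ZMod 5 × ZMod 5, ∑ a ∈ univ.filter (fun a : A => Φ a = t), Ψ a = 0)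
    (h : TripleProductProperty S T U)
    (hS₀ : (univ.filter fun a : A => ρ a ∈ S).card = 3) (hS₁ : (univ.filter fun a : A => τ a ∈ S).card = 3)
    (hT₀ : (univ.filter fun a : A => ρ a ∈ T).card = d) (hT₁ : (univ.filter fun a : A => τ a ∈ T).card = d)
    (hU : (univ.filter fun a : A => ρ a ∈ U).card = (univ.filter fun a : A => τ a ∈ U).card)
    (hV : 3 * (S.card * T.card * U.card) + 8 = 8 * Fintype.card A) : False := by
  classical
  obtain ⟨W, X, Y, x₀, hWc, hXc, -, i₁, i₂, i₃, d₁₂, d₁₃, d₂₃, hcover⟩ :=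
    cube_symmetric_form_of_law hρρ hρτ hτρ hττ hρ hτ hne hsurj hhalf h (by rw [hS₀, hS₁]) (by rw [hT₀, hT₁]) hU hV
  rw [hS₀] at hWc
  rw [hT₀] at hXc
  exact no_cube_form_3x_of_card325 d hfin hA Φ hΦ Ψ hΨ hΨΦ hWc hXc i₁ i₂ i₃ d₁₂ d₁₃ d₂₃ hcover

/-- **Cell form `(3,3,·)@325`**: balanced coset parts, two parts of size `3` (any positions) ⇒ `3|S||T||U| + 8 ≠ 8|A|`, over `A` of
order `325` with `Φ : A ↠ ℤ₅²`, `Ψ : A →+ ZMod 13` as above (every element a double). [folklore] -/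
theorem no_law_cube_three_three_of_card325 (hA : Fintype.card A = 325)
    (hρρ : ∀ a b, ρ a * ρ b = ρ (a + b)) (hρτ : ∀ a b, ρ a * τ b = τ (b - a))
    (hτρ : ∀ a b, τ a * ρ b = τ (a + b)) (hττ : ∀ a b, τ a * τ b = ρ (c₀ + b - a))
    (hρ : Function.Injective ρ) (hτ : Function.Injective τ) (hne : ∀ a b, ρ a ≠ τ b)
    (hsurj : ∀ g, (∃ a, ρ a = g) ∨ (∃ a, τ a = g)) (hhalf : ∀ c : A, ∃ a : A, a + a = c)
    (Φ : A →+ ZMod 5 × ZMod 5) (hΦ : Function.Surjective Φ)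
    (Ψ : A →+ ZMod 13) (hΨ : Ψ ≠ 0) (hΨΦ : ∀ t : ZMod 5 × ZMod 5, ∑ a ∈ univ.filter (fun a : A => Φ a = t), Ψ a = 0)
    (h : TripleProductProperty S T U)
    (hS : (univ.filter fun a : A => ρ a ∈ S).card = (univ.filter fun a : A => τ a ∈ S).card)
    (hT : (univ.filter fun a : A => ρ a ∈ T).card = (univ.filter fun a : A => τ a ∈ T).card)
    (hU : (univ.filter fun a : A => ρ a ∈ U).card = (univ.filter fun a : A => τ a ∈ U).card)
    (h33 : ((univ.filter fun a : A => ρ a ∈ S).card = 3 ∧ (univ.filter fun a : A => ρ a ∈ T).card = 3) ∨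
      ((univ.filter fun a : A => ρ a ∈ T).card = 3 ∧ (univ.filter fun a : A => ρ a ∈ U).card = 3) ∨
      ((univ.filter fun a : A => ρ a ∈ U).card = 3 ∧ (univ.filter fun a : A => ρ a ∈ S).card = 3) ∨
      ((univ.filter fun a : A => ρ a ∈ S).card = 3 ∧ (univ.filter fun a : A => ρ a ∈ T).card = 3) ∨
      ((univ.filter fun a : A => ρ a ∈ T).card = 3 ∧ (univ.filter fun a : A => ρ a ∈ U).card = 3) ∨
      ((univ.filter fun a : A => ρ a ∈ U).card = 3 ∧ (univ.filter fun a : A => ρ a ∈ S).card = 3)) :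
    3 * (S.card * T.card * U.card) + 8 ≠ 8 * Fintype.card A :=
  no_law_cube_two_parts_of_ordered 3 3
    (fun h' hS₀ hS₁ hT₀ hT₁ hU' hV => no_law_cube_3xe_of_card325 3 fin33 hA hρρ hρτ hτρ hττ hρ hτ hne hsurj hhalf Φ hΦ Ψ hΨ hΨΦ h'
      hS₀ hS₁ hT₀ hT₁ hU' hV) h hS hT hU h33

/-- **Cell form `(3,4,·)@325`**: balanced coset parts, a part `3` and another part `4` (any positions) ⇒ `3|S||T||U| + 8 ≠ 8|A|`,
over `A` of order `325` with `Φ : A ↠ ℤ₅²`, `Ψ : A →+ ZMod 13` as above (every element a double). [folklore] -/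
theorem no_law_cube_three_four_of_card325 (hA : Fintype.card A = 325)
    (hρρ : ∀ a b, ρ a * ρ b = ρ (a + b)) (hρτ : ∀ a b, ρ a * τ b = τ (b - a))
    (hτρ : ∀ a b, τ a * ρ b = τ (a + b)) (hττ : ∀ a b, τ a * τ b = ρ (c₀ + b - a))
    (hρ : Function.Injective ρ) (hτ : Function.Injective τ) (hne : ∀ a b, ρ a ≠ τ b)
    (hsurj : ∀ g, (∃ a, ρ a = g) ∨ (∃ a, τ a = g)) (hhalf : ∀ c : A, ∃ a : A, a + a = c)
    (Φ : A →+ ZMod 5 × ZMod 5) (hΦ : Function.Surjective Φ)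
    (Ψ : A →+ ZMod 13) (hΨ : Ψ ≠ 0) (hΨΦ : ∀ t : ZMod 5 × ZMod 5, ∑ a ∈ univ.filter (fun a : A => Φ a = t), Ψ a = 0)
    (h : TripleProductProperty S T U)
    (hS : (univ.filter fun a : A => ρ a ∈ S).card = (univ.filter fun a : A => τ a ∈ S).card)
    (hT : (univ.filter fun a : A => ρ a ∈ T).card = (univ.filter fun a : A => τ a ∈ T).card)
    (hU : (univ.filter fun a : A => ρ a ∈ U).card = (univ.filter fun a : A => τ a ∈ U).card)
    (h34 : ((univ.filter fun a : A => ρ a ∈ S).card = 3 ∧ (univ.filter fun a : A => ρ a ∈ T).card = 4) ∨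
      ((univ.filter fun a : A => ρ a ∈ T).card = 3 ∧ (univ.filter fun a : A => ρ a ∈ U).card = 4) ∨
      ((univ.filter fun a : A => ρ a ∈ U).card = 3 ∧ (univ.filter fun a : A => ρ a ∈ S).card = 4) ∨
      ((univ.filter fun a : A => ρ a ∈ S).card = 4 ∧ (univ.filter fun a : A => ρ a ∈ T).card = 3) ∨
      ((univ.filter fun a : A => ρ a ∈ T).card = 4 ∧ (univ.filter fun a : A => ρ a ∈ U).card = 3) ∨
      ((univ.filter fun a : A => ρ a ∈ U).card = 4 ∧ (univ.filter fun a : A => ρ a ∈ S).card = 3)) :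
    3 * (S.card * T.card * U.card) + 8 ≠ 8 * Fintype.card A :=
  no_law_cube_two_parts_of_ordered 3 4
    (fun h' hS₀ hS₁ hT₀ hT₁ hU' hV => no_law_cube_3xe_of_card325 4 fin34 hA hρρ hρτ hτρ hττ hρ hτ hne hsurj hhalf Φ hΦ Ψ hΨ hΨΦ h'
      hS₀ hS₁ hT₀ hT₁ hU' hV) h hS hT hU h34

/-- **Census instance `(3,3,12)@325`**: for every dihedral-like group over `A = ℤ₅ × ℤ₆₅` (order `325`, any `c₀`) no TPP triple with
balanced coset parts having two parts of size `3` attains `3|S||T||U| + 8 = 8|A|`. [folklore] -/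
theorem no_law_cube_three_three_z5_z65 {ρ τ : ZMod 5 × ZMod 65 → G} {c₀ : ZMod 5 × ZMod 65}
    (hρρ : ∀ a b, ρ a * ρ b = ρ (a + b)) (hρτ : ∀ a b, ρ a * τ b = τ (b - a))
    (hτρ : ∀ a b, τ a * ρ b = τ (a + b)) (hττ : ∀ a b, τ a * τ b = ρ (c₀ + b - a))
    (hρ : Function.Injective ρ) (hτ : Function.Injective τ) (hne : ∀ a b, ρ a ≠ τ b)
    (hsurj : ∀ g, (∃ a, ρ a = g) ∨ (∃ a, τ a = g))
    (h : TripleProductProperty S T U)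
    (hS : (univ.filter fun a => ρ a ∈ S).card = (univ.filter fun a => τ a ∈ S).card)
    (hT : (univ.filter fun a => ρ a ∈ T).card = (univ.filter fun a => τ a ∈ T).card)
    (hU : (univ.filter fun a => ρ a ∈ U).card = (univ.filter fun a => τ a ∈ U).card)
    (h33 : ((univ.filter fun a => ρ a ∈ S).card = 3 ∧ (univ.filter fun a => ρ a ∈ T).card = 3) ∨
      ((univ.filter fun a => ρ a ∈ T).card = 3 ∧ (univ.filter fun a => ρ a ∈ U).card = 3) ∨
      ((univ.filter fun a => ρ a ∈ U).card = 3 ∧ (univ.filter fun a => ρ a ∈ S).card = 3) ∨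
      ((univ.filter fun a => ρ a ∈ S).card = 3 ∧ (univ.filter fun a => ρ a ∈ T).card = 3) ∨
      ((univ.filter fun a => ρ a ∈ T).card = 3 ∧ (univ.filter fun a => ρ a ∈ U).card = 3) ∨
      ((univ.filter fun a => ρ a ∈ U).card = 3 ∧ (univ.filter fun a => ρ a ∈ S).card = 3)) :
    3 * (S.card * T.card * U.card) + 8 ≠ 8 * Fintype.card (ZMod 5 × ZMod 65) :=
  no_law_cube_three_three_of_card325 (by rw [Fintype.card_prod, ZMod.card, ZMod.card]) hρρ hρτ hτρ hττ hρ hτ hne hsurj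
    (exists_add_self_eq_of_card_odd (by rw [Fintype.card_prod, ZMod.card, ZMod.card]; decide))
    projZ5Z65 projZ5Z65_surjective projZ13 projZ13_ne_zero projZ13_fibre_sum h hS hT hU h33

/-- **Census instance `(3,4,9)@325`**: for every dihedral-like group over `A = ℤ₅ × ℤ₆₅` (order `325`, any `c₀`) no TPP triple with
balanced coset parts having a part `3` and another part `4` attains `3|S||T||U| + 8 = 8|A|`. [folklore] -/
theorem no_law_cube_three_four_z5_z65 {ρ τ : ZMod 5 × ZMod 65 → G} {c₀ : ZMod 5 × ZMod 65}
    (hρρ : ∀ a b, ρ a * ρ b = ρ (a + b)) (hρτ : ∀ a b, ρ a * τ b = τ (b - a))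
    (hτρ : ∀ a b, τ a * ρ b = τ (a + b)) (hττ : ∀ a b, τ a * τ b = ρ (c₀ + b - a))
    (hρ : Function.Injective ρ) (hτ : Function.Injective τ) (hne : ∀ a b, ρ a ≠ τ b)
    (hsurj : ∀ g, (∃ a, ρ a = g) ∨ (∃ a, τ a = g))
    (h : TripleProductProperty S T U)
    (hS : (univ.filter fun a => ρ a ∈ S).card = (univ.filter fun a => τ a ∈ S).card)
    (hT : (univ.filter fun a => ρ a ∈ T).card = (univ.filter fun a => τ a ∈ T).card)
    (hU : (univ.filter fun a => ρ a ∈ U).card = (univ.filter fun a => τ a ∈ U).card)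
    (h34 : ((univ.filter fun a => ρ a ∈ S).card = 3 ∧ (univ.filter fun a => ρ a ∈ T).card = 4) ∨
      ((univ.filter fun a => ρ a ∈ T).card = 3 ∧ (univ.filter fun a => ρ a ∈ U).card = 4) ∨
      ((univ.filter fun a => ρ a ∈ U).card = 3 ∧ (univ.filter fun a => ρ a ∈ S).card = 4) ∨
      ((univ.filter fun a => ρ a ∈ S).card = 4 ∧ (univ.filter fun a => ρ a ∈ T).card = 3) ∨
      ((univ.filter fun a => ρ a ∈ T).card = 4 ∧ (univ.filter fun a => ρ a ∈ U).card = 3) ∨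
      ((univ.filter fun a => ρ a ∈ U).card = 4 ∧ (univ.filter fun a => ρ a ∈ S).card = 3)) :
    3 * (S.card * T.card * U.card) + 8 ≠ 8 * Fintype.card (ZMod 5 × ZMod 65) :=
  no_law_cube_three_four_of_card325 (by rw [Fintype.card_prod, ZMod.card, ZMod.card]) hρρ hρτ hτρ hττ hρ hτ hne hsurj
    (exists_add_self_eq_of_card_odd (by rw [Fintype.card_prod, ZMod.card, ZMod.card]; decide))
    projZ5Z65 projZ5Z65_surjective projZ13 projZ13_ne_zero projZ13_fibre_sum h hS hT hU h34

end DihedralLike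

end Summit.MatrixMultiplication.OmegaCensus
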